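import Summits.BirchSwinnertonDyer.Rank1Residual.F1Sign2.LevelZeroSpinLawPosDiscOddAtTwo
import HarnessLib

/-!
# DESC-43 kernel — -desc g33's seven glue theorems (Sketch43 cb1723bae0b43a83 `### §43 kernel glue`, VERBATIM) and REF1-AUDIT §283's probes K283.1–.7 (VERBATIM, re-homed from
# REF1's namespace `REF1_283`) for `F1Sign2/LevelZeroSpinLawPosDiscOddAtTwo.lean` (typer -ty g21; statement + kernel split as the planner asked)

CONTENT (all PROVED, no `sorry`, no new `def`): -desc: `oddEggRescueCell_not_off`, `oddEggRescueCell_not_rescuableSharpAt` (three roots exclude the one-root clause, `I_n*` the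
split-`I_n` clause, `ℓ ≠ 2` the sharp clause), **`pureOddIstar_of_law43`** (DESC-43-L ⟹ DESC-43-A), **`obstructedOddIstar_of_law43`** (DESC-43-L ⟹ DESC-43-B),
`law43_oddEggRescueCell_iff` (under LAW 43, in the odd egg-rescue cell PURE ⟺ ALIGNED — the dichotomy kit job43's TAP/TCP arms test), `selmerTwoCard_ne_four_of_notAligned_allOff`
(DESC-43-U as a Selmer statement), `threeOn_of_twoRescued` (DESC-43-M ⟹ DESC-43-M′ at `Δ_L > 0`); REF1 §283: K283.1 `oddEggRescueCell_not_alignmentExcluding` (the two cells are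
DISJOINT), K283.2 `alignmentExcluding_not_off`, K283.3 `alignmentExcluding_not_rescuableSharpAt`, K283.4 `notFits_of_law43_alignmentExcluding` (LAW 43 ⟹ ¬Fits at every lone
alignment-excluding odd place — DESC-40-B's shape inside LAW 43), K283.5 `oddEggRescueCell_not_good`, K283.6 `switchedOnSharpAt_of_cell_data` (the cell's `SwitchedOnSharpAt`
conjunct is REDUNDANT given `¬HasGoodReductionAt`, R283d), K283.7 `law43_hyps_exclude_threeOn` (L's OTHERS-OFF and «two distinct sharp-ON places» are jointly unsatisfiable — L
is a LONE-place law).  REF1 A1: Probe283 rc 0 · 0 warnings, `#print axioms obstructedOddIstar_of_law43` std; negative control rc 1 at the planted line.  PORT GATE = REF1-AUDIT §283 (2026-08-30T01:06:23Z).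
BSD is not proved by this; 23715 is not closed by this.
-/

open scoped Classical
open WeierstrassCurve Literature.NumberTheory.EllipticCurves Literature.NumberTheory.DiophantineGeometry Polynomial IsDedekindDomain NumberField

namespace Summit.BirchSwinnertonDyer.Rank1Residual.F1Sign2

/-- The odd egg-rescue cell is switched on: not sharp-OFF. -/
theorem oddEggRescueCell_not_off (W : WeierstrassCurve ℚ) (c F : ℤ[X]) (v : HeightOneSpectrum (𝓞 ℚ)) (ℓ : ℕ)
    (h : OddEggRescueCellAt W c F v ℓ) : ¬ SwitchedOffSharpAt W c F v ℓ := by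
  rintro (hoff | ⟨h2, -⟩)
  · exact h.2.1.1 hoff
  · exact h.1 h2

/-- The odd egg-rescue cell is not rescuable (sharp): three roots exclude the one-root clause, `I_n*` excludes the split-`I_n` clause, `ℓ ≠ 2` the sharp clause. -/
theorem oddEggRescueCell_not_rescuableSharpAt (W : WeierstrassCurve ℚ) (c F : ℤ[X]) (v : HeightOneSpectrum (𝓞 ℚ)) (ℓ : ℕ)
    (h : OddEggRescueCellAt W c F v ℓ) : ¬ RescuableSharpAt W c F v ℓ := by
  obtain ⟨hℓ, -, h3, -, n, hk, -⟩ := h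
  rintro ((⟨h1, -⟩ | ⟨-, -, m, hm, -⟩) | ⟨h2, -⟩)
  · exact h1.2 h3.2
  · rw [hk] at hm; cases hm
  · exact hℓ h2

/-- LAW 43 ⟹ DESC-43-A. -/
theorem pureOddIstar_of_law43 (hlaw : LevelZeroSpinLawPosDiscLoneOddPlaceAtTwo) : PureSpinLawOfEggAlignedOddIstarAtTwo := by
  intro W _ _ _ c xnum xden B2 B4 B6 hc hb hs ho hpos hal v₀ ℓ₀ hv hoff hcell
  exact (hlaw W c xnum xden B2 B4 B6 hc hb hs ho hpos v₀ ℓ₀ hv hcell.1 hoff).2 (Or.inr (Or.inr ⟨hcell, hal⟩))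

/-- LAW 43 ⟹ DESC-43-B. -/
theorem obstructedOddIstar_of_law43 (hlaw : LevelZeroSpinLawPosDiscLoneOddPlaceAtTwo) : SpinObstructedOfMisalignedOddIstarAtTwo := by
  intro W _ _ _ c xnum xden B2 B4 B6 hc hb hs ho hpos hnal v₀ ℓ₀ hv hoff hcell hfit
  rcases (hlaw W c xnum xden B2 B4 B6 hc hb hs ho hpos v₀ ℓ₀ hv hcell.1 hoff).1 hfit with hoff₀ | hres | ⟨-, hal⟩
  · exact oddEggRescueCell_not_off W c _ v₀ ℓ₀ hcell hoff₀
  · exact oddEggRescueCell_not_rescuableSharpAt W c _ v₀ ℓ₀ hcell hres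
  · exact hnal hal

/-- LAW 43's ⟸ for the OFF and RESCUABLE disjuncts is DESC-41-A / LAW 40 territory (sign-free); the cell equivalence is the new content. -/
theorem law43_oddEggRescueCell_iff (hlaw : LevelZeroSpinLawPosDiscLoneOddPlaceAtTwo)
    (W : WeierstrassCurve ℚ) [W.IsElliptic] [W.IsGloballyMinimal] [Fact (Irreducible (twoDivisionUCubic W))] (c xnum : ℤ[X]) (xden : ℕ) (B2 B4 B6 : ℤ)
    (hc : CubicDatumFor W c xnum xden) (hb : BInvariantsZ W B2 B4 B6) (hs : selmerTwoCard W = 1) (ho : DegOnePrimesOddClassC c) (hpos : 0 < cubicDiscZ c)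
    (v₀ : HeightOneSpectrum (𝓞 ℚ)) (ℓ₀ : ℕ) (hv : PlaceOver v₀ ℓ₀)
    (hoff : ∀ (w : HeightOneSpectrum (𝓞 ℚ)) (ℓ : ℕ), PlaceOver w ℓ → w ≠ v₀ → SwitchedOffSharpAt W c (twoDivisionCubicZ B2 B4 B6) w ℓ)
    (hcell : OddEggRescueCellAt W c (twoDivisionCubicZ B2 B4 B6) v₀ ℓ₀) :
    CorrectedSpinLawFits W c xnum xden [] ↔ EggAlignedUnitsAtTwo W := by
  refine ⟨fun hfit => ?_, fun hal => pureOddIstar_of_law43 hlaw W c xnum xden B2 B4 B6 hc hb hs ho hpos hal v₀ ℓ₀ hv hoff hcell⟩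
  by_contra hnal
  exact obstructedOddIstar_of_law43 hlaw W c xnum xden B2 B4 B6 hc hb hs ho hpos hnal v₀ ℓ₀ hv hoff hcell hfit

/-- DESC-43-U as a Selmer statement: aligned-or-not decides `#Sel₂ ≠ 4` vs DESC-42-T's `≠ 1` in the all-OFF regime (contrapositive form). -/
theorem selmerTwoCard_ne_four_of_notAligned_allOff (hU : EggAlignedOfSelmerFourAllOffAtTwo)
    (W : WeierstrassCurve ℚ) [W.IsElliptic] [W.IsGloballyMinimal] [Fact (Irreducible (twoDivisionUCubic W))] (c xnum : ℤ[X]) (xden : ℕ) (B2 B4 B6 : ℤ)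
    (hc : CubicDatumFor W c xnum xden) (hb : BInvariantsZ W B2 B4 B6) (ho : DegOnePrimesOddClassC c) (hpos : 0 < cubicDiscZ c)
    (hoff : ∀ (v : HeightOneSpectrum (𝓞 ℚ)) (ℓ : ℕ), PlaceOver v ℓ → SwitchedOffSharpAt W c (twoDivisionCubicZ B2 B4 B6) v ℓ)
    (hnal : ¬ EggAlignedUnitsAtTwo W) : selmerTwoCard W ≠ 4 :=
  fun hs => hnal (hU W c xnum xden B2 B4 B6 hc hb hs ho hpos hoff)

/-- DESC-43-M′ specialises THM 39.2 / DESC-41-B territory: with three ON places DESC-43-M's conclusion is contradictory, so M ⟹ M′ at `Δ_L > 0`. -/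
theorem threeOn_of_twoRescued (hM : TwoRescuedPlacesOfPureMultiPlaceAtTwo)
    (W : WeierstrassCurve ℚ) [W.IsElliptic] [W.IsGloballyMinimal] [Fact (Irreducible (twoDivisionUCubic W))] (c xnum : ℤ[X]) (xden : ℕ) (B2 B4 B6 : ℤ)
    (hc : CubicDatumFor W c xnum xden) (hb : BInvariantsZ W B2 B4 B6) (hs : selmerTwoCard W = 1) (ho : DegOnePrimesOddClassC c) (hpos : 0 < cubicDiscZ c)
    (v₁ v₂ v₃ : HeightOneSpectrum (𝓞 ℚ)) (ℓ₁ ℓ₂ ℓ₃ : ℕ) (h12 : v₁ ≠ v₂) (h13 : v₁ ≠ v₃) (h23 : v₂ ≠ v₃)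
    (p₁ : PlaceOver v₁ ℓ₁) (p₂ : PlaceOver v₂ ℓ₂) (p₃ : PlaceOver v₃ ℓ₃)
    (o₁ : SwitchedOnSharpAt W c (twoDivisionCubicZ B2 B4 B6) v₁ ℓ₁) (o₂ : SwitchedOnSharpAt W c (twoDivisionCubicZ B2 B4 B6) v₂ ℓ₂)
    (o₃ : SwitchedOnSharpAt W c (twoDivisionCubicZ B2 B4 B6) v₃ ℓ₃) : ¬ CorrectedSpinLawFits W c xnum xden [] := by
  intro hfit
  rcases (hM W c xnum xden B2 B4 B6 hc hb hs ho hpos v₁ v₂ ℓ₁ ℓ₂ h12 p₁ p₂ o₁ o₂ hfit).1 v₃ ℓ₃ p₃ o₃ with h | h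
  · exact h13 h.symm
  · exact h23 h.symm

/-! ### REF1-AUDIT §283 kernel probes (`REF1-data/b283/Probe283_block.lean` eafb8d18d9a02d11, K283.1–.7 VERBATIM; REF1's namespace `REF1_283` replaced by the file's) -/

/-- K283.1: the two §43 cells are DISJOINT (three roots vs one root; `I_n*` vs `I_n`). -/
theorem oddEggRescueCell_not_alignmentExcluding (W : WeierstrassCurve ℚ) (c F : ℤ[X]) (v : HeightOneSpectrum (𝓞 ℚ)) (ℓ : ℕ)
    (h : OddEggRescueCellAt W c F v ℓ) : ¬ AlignmentExcludingOddCellAt W c F v ℓ := by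
  obtain ⟨-, -, h3, -, n, hk, -⟩ := h
  rintro ⟨-, -, (⟨h1, -⟩ | ⟨-, -, m, hm, -⟩)⟩
  · exact h1.2 h3.2
  · rw [hk] at hm; cases hm

/-- K283.2: an alignment-excluding cell is switched on: not sharp-OFF. -/
theorem alignmentExcluding_not_off (W : WeierstrassCurve ℚ) (c F : ℤ[X]) (v : HeightOneSpectrum (𝓞 ℚ)) (ℓ : ℕ)
    (h : AlignmentExcludingOddCellAt W c F v ℓ) : ¬ SwitchedOffSharpAt W c F v ℓ := by
  rintro (hoff | ⟨h2, -⟩)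
  · exact h.2.1.1 hoff
  · exact h.1 h2

/-- K283.3: an alignment-excluding cell is NOT rescuable (sharp): `𝔯` odd kills LAW 40's one-root clause, one root kills the split-`I_{4m}` clause,
`n ≡ 2 (4)` kills `4 ∣ n`, `ℓ ≠ 2` the additive-2 clause. -/
theorem alignmentExcluding_not_rescuableSharpAt (W : WeierstrassCurve ℚ) (c F : ℤ[X]) (v : HeightOneSpectrum (𝓞 ℚ)) (ℓ : ℕ)
    (h : AlignmentExcludingOddCellAt W c F v ℓ) : ¬ RescuableSharpAt W c F v ℓ := by
  obtain ⟨hℓ, -, hcell⟩ := h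
  rintro ((⟨h1, hno⟩ | ⟨h3, -, m, hm, h4⟩) | ⟨h2, -⟩)
  · rcases hcell with ⟨-, hodd⟩ | ⟨h3', -, -⟩
    · exact hno hodd
    · exact h1.2 h3'.2
  · rcases hcell with ⟨h1', -⟩ | ⟨-, -, n, hn, hmod⟩
    · exact h1'.2 h3.2
    · rw [hn] at hm; cases hm; omega
  · exact hℓ h2

/-- K283.4: LAW 43 ⟹ the obstruction at every alignment-excluding lone odd place (DESC-40-B's shape inside LAW 43; consistency of L with T's cells). -/
theorem notFits_of_law43_alignmentExcluding (hlaw : LevelZeroSpinLawPosDiscLoneOddPlaceAtTwo)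
    (W : WeierstrassCurve ℚ) [W.IsElliptic] [W.IsGloballyMinimal] [Fact (Irreducible (twoDivisionUCubic W))] (c xnum : ℤ[X]) (xden : ℕ) (B2 B4 B6 : ℤ)
    (hc : CubicDatumFor W c xnum xden) (hb : BInvariantsZ W B2 B4 B6) (hs : selmerTwoCard W = 1) (ho : DegOnePrimesOddClassC c) (hpos : 0 < cubicDiscZ c)
    (v₀ : HeightOneSpectrum (𝓞 ℚ)) (ℓ₀ : ℕ) (hv : PlaceOver v₀ ℓ₀)
    (hoff : ∀ (w : HeightOneSpectrum (𝓞 ℚ)) (ℓ : ℕ), PlaceOver w ℓ → w ≠ v₀ → SwitchedOffSharpAt W c (twoDivisionCubicZ B2 B4 B6) w ℓ)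
    (hcell : AlignmentExcludingOddCellAt W c (twoDivisionCubicZ B2 B4 B6) v₀ ℓ₀) :
    ¬ CorrectedSpinLawFits W c xnum xden [] := by
  intro hfit
  rcases (hlaw W c xnum xden B2 B4 B6 hc hb hs ho hpos v₀ ℓ₀ hv hcell.1 hoff).1 hfit with hoff₀ | hres | ⟨hegg, -⟩
  · exact alignmentExcluding_not_off W c _ v₀ ℓ₀ hcell hoff₀
  · exact alignmentExcluding_not_rescuableSharpAt W c _ v₀ ℓ₀ hcell hres
  · exact oddEggRescueCell_not_alignmentExcluding W c _ v₀ ℓ₀ hegg hcell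

/-- K283.5: inside the odd egg-rescue cell, `SwitchedOnSharpAt` is carried explicitly, so the cell EXCLUDES good reduction at `v` in the kernel
(the tree links `kodairaSymbolAt = I_n*` to `¬ HasGoodReductionAt` only through the named fact `isGood_kodairaSymbolAt_iff`). -/
theorem oddEggRescueCell_not_good (W : WeierstrassCurve ℚ) (c F : ℤ[X]) (v : HeightOneSpectrum (𝓞 ℚ)) (ℓ : ℕ)
    (h : OddEggRescueCellAt W c F v ℓ) : ¬ W.HasGoodReductionAt v := fun hg =>
  h.2.1.1 (Or.inl hg)

/-- K283.6: conversely the cell's `SwitchedOnSharpAt` conjunct is REDUNDANT GIVEN `¬ HasGoodReductionAt`: with `ℓ ≠ 2`, `c_v = 4`, three local roots and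
type `I_n*`, no §39 OFF disjunct can fire. -/
theorem switchedOnSharpAt_of_cell_data (W : WeierstrassCurve ℚ) (c F : ℤ[X]) (v : HeightOneSpectrum (𝓞 ℚ)) (ℓ : ℕ)
    (hℓ : ℓ ≠ 2) (hng : ¬ W.HasGoodReductionAt v) (h3 : ThreeLocalRootsC c ℓ) (hc4 : W.tamagawaNumberAt v = 4)
    (hk : ∃ n : ℕ, W.kodairaSymbolAt v = KodairaSymbol.Istar n) : SwitchedOnSharpAt W c F v ℓ := by
  obtain ⟨n, hn⟩ := hk
  refine ⟨?_, Or.inl hℓ⟩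
  rintro (hg | hodd | hnr | ⟨m, -, hm, -⟩ | ⟨m, -, hc2, -⟩)
  · exact hng hg
  · rw [hc4] at hodd; exact (Nat.not_odd_iff_even.mpr (by decide)) hodd
  · exact hnr h3.1
  · rw [hn] at hm; cases hm
  · rw [hc4] at hc2; exact absurd hc2 (by decide)

/-- K283.7: DESC-43-M′ needs only two of its three places when one of them is an alignment-excluding lone cell? No — but M ⟹ M′ (the typer's glue) and,
symmetrically, LAW 43 says nothing about multi-place configurations: the hypotheses OTHERS-OFF(v₀) of L and «three ON places» of M′ are jointly unsatisfiable. -/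
theorem law43_hyps_exclude_threeOn (W : WeierstrassCurve ℚ) (c F : ℤ[X])
    (v₀ v₁ v₂ : HeightOneSpectrum (𝓞 ℚ)) (ℓ₁ ℓ₂ : ℕ) (h12 : v₁ ≠ v₂)
    (hoff : ∀ (w : HeightOneSpectrum (𝓞 ℚ)) (ℓ : ℕ), PlaceOver w ℓ → w ≠ v₀ → SwitchedOffSharpAt W c F w ℓ)
    (p₁ : PlaceOver v₁ ℓ₁) (p₂ : PlaceOver v₂ ℓ₂)
    (o₁ : SwitchedOnSharpAt W c F v₁ ℓ₁) (o₂ : SwitchedOnSharpAt W c F v₂ ℓ₂) : False := by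
  by_cases h1 : v₁ = v₀
  · have h2 : v₂ ≠ v₀ := fun h => h12 (h1.trans h.symm)
    rcases hoff v₂ ℓ₂ p₂ h2 with hoff₂ | ⟨-, hnm, hnadd⟩
    · exact o₂.1 hoff₂
    · rcases o₂.2 with hℓ | hmul | hadd
      · rcases hoff v₂ ℓ₂ p₂ h2 with h' | ⟨h2eq, -⟩
        · exact o₂.1 h'
        · exact hℓ h2eq
      · exact hnm hmul
      · exact hnadd hadd
  · rcases hoff v₁ ℓ₁ p₁ h1 with hoff₁ | ⟨h2eq, hnm, hnadd⟩
    · exact o₁.1 hoff₁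
    · rcases o₁.2 with hℓ | hmul | hadd
      · exact hℓ h2eq
      · exact hnm hmul
      · exact hnadd hadd

end Summit.BirchSwinnertonDyer.Rank1Residual.F1Sign2
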